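import Summits.AtomisticToContinuum.FouriersLaw.Theorems.BondHeatUncertaintyExtensiveSnapshotIrreversibilityEnergyWindowScoreOrders
import Summits.AtomisticToContinuum.FouriersLaw.Theorems.BondHeatUncertaintyExtensiveSnapshotIrreversibilityEnergyWindowHessianSplitE
import Summits.AtomisticToContinuum.FouriersLaw.Theorems.BondHeatUncertaintyExtensiveSnapshotIrreversibilityEnergyWindowWeightsGlue
import Summits.AtomisticToContinuum.FouriersLaw.Theorems.BondHeatUncertaintyExtensiveSnapshotIrreversibilityEnergyWindowSkeletonSecondVariationMoments

/-!
(SPLIT FOR THE 400-LINE CAP by the landing lane, hand-2 g33: this file = part 1 of 2; sequels `…BondHeatUncertaintyExtensiveSnapshotIrreversibilityEnergyWindowScoreOrderOne` import it in a chain; same namespace, all FQNs unchanged.)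
# Bond heat uncertainty — node «ScoreOrderLadder», part V: the ORDER-1 JUNCTION
  (MC∞) ∧ (RW₁) ⟹ (SD₁) and the headline (MC∞) ∧ (SW⁰₂) ⟹ (MD₂)

Cell `decomp-a2c`, lens «grading / quantitative ladder», generation 85 (critic row 1202 (3)(a):
«the junction `md₂_of_skeletonGramLimitInverseMoments_of_sw (h₁ : SkeletonGramLimitInverseMoments)
(h₂ : SW⁰₂) : DensityScoreDualBound₂`, without proof holes»).  Sequel of part U
(`…EnergyWindowScoreOrders`:
the order split of (MD₂), the pieces (RW₁) `GramControlledWeightMoments`, (RW₂ᵈ)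
`GramConditionalScoreDualSecond`, (SW⁰₂) `SkeletonWeightControl₂`, the order-2 junction).

§1 Density-side helpers for a jointly smooth transition density `p` of the kernels with baths
  `T ± δ/2` (`IsTransitionDensity`): the LAW identity `∫ φ(y) p(s,x,y) dy = E[φ(E_m(x,·))]` at
  every skeleton level (`integral_mul_density_eq_integral_skelFlowMapAt`; tree
  `integral_pertKernel_eq_integral_skelFlowMapAt` + `IsTransitionDensity.kernel_eq`); the `L^r`
  identity `E|G(E_m(x,·))|^r = ‖G‖^r_{L^r(p(s,x,·))}` (`lintegral_rpow_abs_comp_eq`); the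
  phase-space integration by parts in the arrival bath momentum
  `∫ G ∂_{y_b}p(s,x,·) = −∫ ∂_bG p(s,x,·)` for `G ∈ C¹_c` (no boundary terms); continuity of
  `x ↦ ∫ |G|^r p(s,x,y) dy` (dominated convergence on `tsupport G × B̄(x₀,1)`); and the
  derivative of `c ↦ ∫ G(y) p(s, z + c(0,e_b), y) dy` at `c = 0` under the integral sign
  (`hasDerivAt_integral_mul_density`, Mathlib's `hasDerivAt_integral_of_dominated_loc_of_deriv_le`
  with the local constant bound from joint `C¹` smoothness), which IS `∫ G ∂_{x_b}p(s,·,y)(z) dy`.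
§2 ★★ `densityScoreDualBoundFirst_of_gram : (MC∞) → (RW₁) → (SD₁)`.  Given `r > 1`, `ε > 0`:
  `q = r/(r−1)`; (RW₁) at `(q, ε)` yields `(q', ε', δ₀ᴿ, K, μ)`; the tree bridge (MC∞) ⇒ (MC⁰_κ)
  (`skeletonGramInverseMomentsRegBody_of_limit`) at `(q', ε')` yields `(δ₀ᴹ, C)` and, for every
  point `x`, every `κ > 0`, a level `m₁` and a measurable frame minorant `Λ` of all `Γ_m + κ`,
  `m ≥ m₁`, with `E[Λ^{-q'}] ≤ (C e^{ε'H(x)})^{q'}`; feeding `Λ` to (RW₁) gives the EVENTUAL moment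
  bounds `E|w_{m,κ}|^q, E|w'_{m,κ}|^q ≤ (K(1+C)^μ e^{εH(x)})^q`, `m ≥ m₁(x,κ)` — exactly hypothesis
  `h2` of the tree's path-level bounds `abs_integral_partialP_comp_le` (W-3, arrival) and
  `abs_integral_partialP_dep_le` (W-5, departure), whose `h1` is the `L^r` identity of §1 and whose
  surjectivity input is the tree theorem `skeletonEventualSurjectivity` (W-7b); (JMˣ)₂ is the tree
  theorem `skeletonSecondVariationMoments`.  ARRIVAL (`i = 2`): integrate by parts in `y_b`, pass
  to the Wiener pair by the law identity, apply W-3: `|∫ G ∂_{y_b}p| ≤ A₁(z) A₂(z)`,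
  `A₁(x) = ‖G‖_{L^r(p(s,x,·))}`, `A₂(x) = K(1+C)^μ e^{εH(x)}`.  DEPARTURE (`i = 0`): by the law
  identity and the tree's segment identity `integral_comp_sub_eq_mul_integral_partialP` (T-b,
  Fubini), `Φ(c) − Φ(0) = c ∫₀¹ Ψ_m(z + τc(0,e_b)) dτ` for `Φ(c) = ∫ G(y) p(s, z + c(0,e_b), y) dy`,
  and W-5 AT EVERY POINT of the segment gives `|Ψ_m(x)| ≤ A₁(x)A₂(x)`; continuity of `A₁A₂` along
  the segment and `HasDerivAt.le_of_lip'` turn the Lipschitz bound near `c = 0` into the bound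
  `|Φ'(0)| ≤ A₁(z)A₂(z)` on the derivative of §1.  Final constants `δ₀ = min(δ₀ᴿ, δ₀ᴹ, T)`,
  `C_final = K(1+C)^μ`.  The proved (MC∞) is used ONLY through the bridge (MC∞) ⇒ (MC⁰_κ), i.e.
  through frame minorants of the REGULARISED SKELETON Gram matrices `Γ_m + κ` that the controls
  `skelCtrlArr/Dep` invert — no identification of the limit floor with the Malliavin matrix of the
  continuum SDE is used (critic row 1202 (3)(b)).
  SIZING (census): the expected proof of (RW₁) instantiates `(q', ε', μ) = (4q, ε/4, 2)` (part U,
  docstring of `GramControlledWeightMoments`); the junction consumes WHATEVER `(q', ε', μ)` (RW₁)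
  returns — it calls (MC⁰_κ) at `(q', ε')` and multiplies `K` by `(1 + C)^μ`.
§3 ★★★ `densityScoreDualBound₂_of_skeletonGramLimitInverseMoments_of_sw : (MC∞) → (SW⁰₂) → (MD₂)`
  (the critic's `md₂_of_skeletonGramLimitInverseMoments_of_sw`; order split of part U + §2 + the
  order-2 junction of part U), and the junctions to S3
  (`kernelTemperatureLipschitz_of_skeletonGramLimit_of_sw`, with (Dˢ)) and to K_fix
  (`snapshotKLUpperExpansion_of_atoms₇SW`).
§4 THE HYPOTHESIS OF (RW₁) IS CONSUMABLE (critic rows 1202 (3)(c), 1212 (2)): the constant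
  `Λ := κ` is a measurable frame minorant of every `Γ_m + κ` (`Γ_m ⪰ 0`, tree
  `dotProduct_skelGramPath_mulVec_nonneg`) with `E[Λ^{-q'}] = κ^{-q'} ≤ (κ⁻¹e^{ε'H(z)})^{q'}`
  (`H ≥ 0`), so (RW₁) ALONE yields, at every level `m` and every `κ > 0`, the moment bounds
  `E|w_{m,κ}|^q, E|w'_{m,κ}|^q ≤ (K(1+κ⁻¹)^μ e^{εH(z)})^q` with a `κ`-DEPENDENT constant
  (`skelMoment_le_of_gramControlledWeightMoments_const`) — the `κ`-UNIFORM constant of §2 is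
  located in h₁ = (MC∞) and nowhere else.
No new instance / notation / option; no proof holes.  References: D. Nualart, *The Malliavin
Calculus and Related Topics* (2006), Prop. 2.1.4, §2.3; N. Cuneo, J.-P. Eckmann, M. Hairer,
L. Rey-Bellet, Electron. J. Probab. 23 (2018) no. 55, Prop. 3.2, §3 eq. (3.4).
-/

noncomputable section

namespace Summit.AtomisticToContinuum.FouriersLaw.Theorems.ExtensiveSnapshotIrreversibility.EnergyWindow

open MeasureTheory Filter Topology Set Metric
open scoped ENNReal NNReal Matrix ContDiff
open Literature.MathematicalPhysics.KineticTheory.HeatConduction Literature.Probability.Process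

/-! ## 1. Density-side helpers -/

section Density

variable {ω₂ lam β γ : ℝ} (hω : 0 < ω₂) (hl : 0 < lam) (hβ : 0 < β) (hγ : 0 < γ) (N : ℕ)
  (T δ : ℝ) {p : ℝ → PhaseSpace N → PhaseSpace N → ℝ}

include hω hl hβ hγ in
/-- **The law at every skeleton level**: for a transition density `p` of the kernels with baths
`T ± δ/2`, `0 < s ≤ 1` and measurable `φ`, `∫ φ(y) p(s,x,y) dy = E[φ(E^{s}_{m}(x, R_m B, Ξ_m B))]`
(`IsTransitionDensity.kernel_eq`, `integral_pertKernel_eq_integral_skelFlowMapAt`). [folklore] -/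
theorem integral_mul_density_eq_integral_skelFlowMapAt
    (hp : IsTransitionDensity ω₂ lam β γ N (T + δ / 2) (T - δ / 2) p) {s : ℝ} (hs0 : 0 < s)
    (hs1 : s ≤ 1) (m : ℕ) (x : PhaseSpace N) {φ : PhaseSpace N → ℝ} (hφ : Measurable φ) :
    ∫ y, φ y * p s x y =
      ∫ wp, φ (skelFlowMapAt ω₂ lam β γ N (T + δ / 2) (T - δ / 2) s m x (pairRem m wp)
        (pairSkel m wp)) ∂wienerPair := by
  have hpm : Measurable (p s x) := (hp.contDiff_right hs0 x).continuous.measurable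
  rw [← integral_pertKernel_eq_integral_skelFlowMapAt hω hl.le hβ.le hγ.le N T δ ⟨hs0.le, hs1⟩ m x
    hφ, pertKernel, hp.kernel_eq hs0 x, integral_withDensity_ofReal_phaseSpace hpm (hp.2.1 s hs0 x)]
  exact integral_congr_ae (ae_of_all _ fun y => mul_comm _ _)

include hω hl hβ hγ in
/-- **`E|G(E_m(x,·))|^r = (‖G‖_{L^r(p(s,x,·))})^r`** as Lebesgue integrals, for continuous
compactly supported `G` and `r > 0`: hypothesis `h1` of the tree's path-level bounds with
`A₁(x) = (∫ |G|^r p(s,x,y) dy)^{1/r}`. [folklore] -/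
theorem lintegral_rpow_abs_comp_eq (hp : IsTransitionDensity ω₂ lam β γ N (T + δ / 2) (T - δ / 2) p)
    {s : ℝ} (hs0 : 0 < s) (hs1 : s ≤ 1) {G : PhaseSpace N → ℝ} (hG : Continuous G)
    (hGc : HasCompactSupport G) {r : ℝ} (hr : 0 < r) (m : ℕ) (x : PhaseSpace N) :
    ∫⁻ wp, ENNReal.ofReal |G (skelFlowMapAt ω₂ lam β γ N (T + δ / 2) (T - δ / 2) s m x
        (pairRem m wp) (pairSkel m wp))| ^ r ∂wienerPair =
      ENNReal.ofReal (((∫ y, |G y| ^ r * p s x y) ^ (1 / r)) ^ r) := by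
  obtain ⟨M, hM⟩ := hG.bounded_above_of_compact_support hGc
  have hI : ∫ y, |G y| ^ r * p s x y = ∫ wp, |G (skelFlowMapAt ω₂ lam β γ N (T + δ / 2)
      (T - δ / 2) s m x (pairRem m wp) (pairSkel m wp))| ^ r ∂wienerPair :=
    integral_mul_density_eq_integral_skelFlowMapAt hω hl hβ hγ N T δ hp hs0 hs1 m x
      (hG.measurable.abs.pow_const r)
  have hI0 : 0 ≤ ∫ y, |G y| ^ r * p s x y :=
    integral_nonneg fun y => mul_nonneg (Real.rpow_nonneg (abs_nonneg _) _) (hp.2.1 s hs0 x y)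
  have hint : Integrable (fun wp : WienerPair => |G (skelFlowMapAt ω₂ lam β γ N (T + δ / 2)
      (T - δ / 2) s m x (pairRem m wp) (pairSkel m wp))| ^ r) wienerPair := by
    refine (integrable_const (max M 0 ^ r)).mono'
      ((measurable_comp_skelFlowMapAt_path hω hl hβ hγ s m x hG).abs.pow_const
        r).aestronglyMeasurable
      (ae_of_all _ fun wp => ?_)
    rw [Real.norm_eq_abs, abs_of_nonneg (Real.rpow_nonneg (abs_nonneg _) _)]
    exact Real.rpow_le_rpow (abs_nonneg _)
      (((Real.norm_eq_abs _).symm.le.trans (hM _)).trans (le_max_left _ _)) hr.le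
  rw [one_div, Real.rpow_inv_rpow hI0 hr.ne', hI,
    ofReal_integral_eq_lintegral_ofReal hint
      (ae_of_all _ fun wp => Real.rpow_nonneg (abs_nonneg _) _)]
  exact lintegral_congr fun wp => ENNReal.ofReal_rpow_of_nonneg (abs_nonneg _) hr.le

omit hω hl hβ hγ in
/-- **Integration by parts in the arrival bath momentum**: for `G ∈ C¹_c` and the `C¹` density
slice `p(s,x,·)`, `∫ G ∂_{y_b}p(s,x,·) = −∫ ∂_{p_b}G · p(s,x,·)` (Lebesgue measure on phase space is
an additive Haar measure; every product is continuous with compact support). [folklore] -/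
theorem integral_mul_partialP_density_eq_neg {T_L T_R : ℝ}
    (hp : IsTransitionDensity ω₂ lam β γ N T_L T_R p) {s : ℝ} (hs0 : 0 < s) (x : PhaseSpace N)
    (b : Fin N) {G : PhaseSpace N → ℝ} (hG : ContDiff ℝ 1 G) (hGc : HasCompactSupport G) :
    ∫ y, G y * partialP b (p s x) y = -∫ y, partialP b G y * p s x y := by
  haveI := isAddHaarMeasure_volume_phaseSpace N
  have hf₀C : ContDiff ℝ 1 (p s x) := hp.contDiff_right hs0 x
  have hf₀d : Differentiable ℝ (p s x) := hf₀C.differentiable one_ne_zero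
  have hGd : Differentiable ℝ G := hG.differentiable one_ne_zero
  have e1 : (fun y => G y * partialP b (p s x) y) = fun y =>
      G y * fderiv ℝ (p s x) y (((0 : Fin N → ℝ), Pi.single b 1) : PhaseSpace N) := by
    funext y; rw [partialP_eq_fderiv hf₀d b]
  have e2 : (fun y => partialP b G y * p s x y) = fun y =>
      fderiv ℝ G y (((0 : Fin N → ℝ), Pi.single b 1) : PhaseSpace N) * p s x y := by
    funext y; rw [partialP_eq_fderiv hGd b]
  have hdGc : Continuous fun y => fderiv ℝ G y (((0 : Fin N → ℝ), Pi.single b 1) : PhaseSpace N) :=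
    (hG.continuous_fderiv one_ne_zero).clm_apply continuous_const
  have hdGs : HasCompactSupport fun y =>
      fderiv ℝ G y (((0 : Fin N → ℝ), Pi.single b 1) : PhaseSpace N) :=
    hGc.fderiv_apply (𝕜 := ℝ) _
  have hdf₀c : Continuous fun y =>
      fderiv ℝ (p s x) y (((0 : Fin N → ℝ), Pi.single b 1) : PhaseSpace N) :=
    (hf₀C.continuous_fderiv one_ne_zero).clm_apply continuous_const
  rw [e1, e2]
  exact integral_mul_fderiv_eq_neg_fderiv_mul_of_integrable (μ := (volume : Measure (PhaseSpace N)))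
    (f := G) (g := p s x) (v := (((0 : Fin N → ℝ), Pi.single b 1) : PhaseSpace N))
    ((hdGc.mul hf₀C.continuous).integrable_of_hasCompactSupport hdGs.mul_right)
    ((hG.continuous.mul hdf₀c).integrable_of_hasCompactSupport hGc.mul_right)
    ((hG.continuous.mul hf₀C.continuous).integrable_of_hasCompactSupport hGc.mul_right)
    (fun y _ => hGd y) (fun y _ => hf₀d y)

omit hω hl hβ hγ in
/-- **Continuity of `x ↦ ∫ |G(y)|^r p(s,x,y) dy`** (`G` continuous with compact support, `r > 0`):
dominated convergence with the constant bound `sup|G|^r · sup_{B̄(x₀,1) × tsupport G} p` on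
`tsupport G`. [folklore] -/
theorem continuousAt_integral_rpow_abs_mul_density {T_L T_R : ℝ}
    (hp : IsTransitionDensity ω₂ lam β γ N T_L T_R p) {s : ℝ} (hs0 : 0 < s)
    {G : PhaseSpace N → ℝ} (hG : Continuous G) (hGc : HasCompactSupport G) {r : ℝ} (hr : 0 < r)
    (x₀ : PhaseSpace N) : ContinuousAt (fun x => ∫ y, |G y| ^ r * p s x y) x₀ := by
  obtain ⟨M, hM⟩ := hG.bounded_above_of_compact_support hGc
  have hpc : Continuous fun w : PhaseSpace N × PhaseSpace N => p s w.1 w.2 :=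
    (hp.contDiff_uncurry hs0).continuous
  obtain ⟨C₀, hC₀⟩ := ((isCompact_closedBall x₀ 1).prod hGc.isCompact).exists_bound_of_continuousOn
    hpc.continuousOn
  have hKm : MeasurableSet (tsupport G) := (isClosed_tsupport G).measurableSet
  refine continuousAt_of_dominated (bound := (tsupport G).indicator fun _ => max M 0 ^ r * max C₀ 0)
    ?_ ?_ ?_ ?_
  · exact Eventually.of_forall fun x =>
      ((hG.measurable.abs.pow_const r).mul
        (hp.contDiff_right hs0 x).continuous.measurable).aestronglyMeasurable
  · filter_upwards [closedBall_mem_nhds x₀ one_pos] with x hx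
    refine ae_of_all _ fun y => ?_
    by_cases hy : y ∈ tsupport G
    · rw [Set.indicator_of_mem hy, Real.norm_eq_abs, abs_mul,
        abs_of_nonneg (Real.rpow_nonneg (abs_nonneg _) _)]
      have h1 : |G y| ^ r ≤ max M 0 ^ r := Real.rpow_le_rpow (abs_nonneg _)
        (((Real.norm_eq_abs _).symm.le.trans (hM y)).trans (le_max_left _ _)) hr.le
      have h2 : |p s x y| ≤ max C₀ 0 := by
        have h := hC₀ (x, y) ⟨hx, hy⟩
        rw [Real.norm_eq_abs] at h
        exact h.trans (le_max_left _ _)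
      exact mul_le_mul h1 h2 (abs_nonneg _) (Real.rpow_nonneg (le_max_right _ _) _)
    · rw [Set.indicator_of_notMem hy, image_eq_zero_of_notMem_tsupport hy, abs_zero,
        Real.zero_rpow hr.ne', zero_mul, norm_zero]
  · rw [integrable_indicator_iff hKm]
    exact integrableOn_const (hGc.isCompact.measure_lt_top).ne
  · exact ae_of_all _ fun y =>
      (continuous_const.mul (hp.contDiff_left hs0 y).continuous).continuousAt

omit hω hl hβ hγ in
/-- The departure directional derivative `(y, x) ↦ D_x p(s,·,y)(x)·(0,e_b)` is jointly continuous
(joint `C¹` smoothness of the density). [folklore] -/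
theorem continuous_fderiv_density_left {T_L T_R : ℝ}
    (hp : IsTransitionDensity ω₂ lam β γ N T_L T_R p) {s : ℝ} (hs0 : 0 < s) (b : Fin N) :
    Continuous fun w : PhaseSpace N × PhaseSpace N =>
      fderiv ℝ (fun q => p s q w.1) w.2 (((0 : Fin N → ℝ), Pi.single b 1) : PhaseSpace N) := by
  have hu : ContDiff ℝ 1 (Function.uncurry
      fun (w : PhaseSpace N × PhaseSpace N) (q : PhaseSpace N) => p s q w.1) :=
    (hp.contDiff_uncurry hs0).comp (contDiff_snd.prodMk (contDiff_fst.comp contDiff_fst))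
  exact (hu.fderiv_apply (n := 0) contDiff_snd contDiff_const (by norm_num)).continuous

omit hω hl hβ hγ in
/-- **The departure derivative under the integral sign.**  For `G ∈ C¹_c`, a transition density
`p`, `s > 0`, a bath site `b` and `z`:  `c ↦ ∫ G(y) p(s, z + c(0,e_b), y) dy` has derivative
`∫ G(y) ∂_{x_b}p(s,·,y)(z) dy = ∫ G · densityDeriv₀ dy` at `c = 0` (Mathlib's
`hasDerivAt_integral_of_dominated_loc_of_deriv_le`, constant bound on
`tsupport G × B̄(z, ‖(0,e_b)‖)`
from `continuous_fderiv_density_left`). [folklore] -/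
theorem hasDerivAt_integral_mul_density {T_L T_R : ℝ}
    (hp : IsTransitionDensity ω₂ lam β γ N T_L T_R p) {s : ℝ} (hs0 : 0 < s) (b : Fin N)
    (z : PhaseSpace N) {G : PhaseSpace N → ℝ} (hG : ContDiff ℝ 1 G) (hGc : HasCompactSupport G) :
    HasDerivAt (fun c : ℝ => ∫ y, G y *
        p s (z + c • (((0 : Fin N → ℝ), Pi.single b 1) : PhaseSpace N)) y)
      (∫ y, G y * densityDeriv p s b z 0 y) 0 := by
  have hDc := continuous_fderiv_density_left N hp hs0 b
  have hGc' : Continuous G := hG.continuous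
  -- the local constant bound
  obtain ⟨C₁, hC₁⟩ := (hGc.isCompact.prod (isCompact_closedBall z
    ‖(((0 : Fin N → ℝ), Pi.single b 1) : PhaseSpace N)‖)).exists_bound_of_continuousOn
    ((hGc'.comp continuous_fst).mul hDc).continuousOn
  have hKm : MeasurableSet (tsupport G) := (isClosed_tsupport G).measurableSet
  have hseg : ∀ c : ℝ, c ∈ ball (0 : ℝ) 1 →
      z + c • (((0 : Fin N → ℝ), Pi.single b 1) : PhaseSpace N) ∈
        closedBall z ‖(((0 : Fin N → ℝ), Pi.single b 1) : PhaseSpace N)‖ := by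
    intro c hc
    rw [mem_closedBall_iff_norm, add_sub_cancel_left, norm_smul]
    have hc1 : ‖c‖ ≤ 1 := (mem_ball_zero_iff.1 hc).le
    exact mul_le_of_le_one_left (norm_nonneg _) hc1
  have hmain := hasDerivAt_integral_of_dominated_loc_of_deriv_le
    (μ := (volume : Measure (PhaseSpace N)))
    (F := fun (c : ℝ) (y : PhaseSpace N) =>
      G y * p s (z + c • (((0 : Fin N → ℝ), Pi.single b 1) : PhaseSpace N)) y)
    (F' := fun (c : ℝ) (y : PhaseSpace N) => G y * fderiv ℝ (fun q => p s q y)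
      (z + c • (((0 : Fin N → ℝ), Pi.single b 1) : PhaseSpace N))
      (((0 : Fin N → ℝ), Pi.single b 1) : PhaseSpace N))
    (x₀ := (0 : ℝ)) (bound := (tsupport G).indicator fun _ => C₁) (ball_mem_nhds (0 : ℝ) one_pos)
    ?_ ?_ ?_ ?_ ?_ ?_
  · -- identification of the derivative with `∫ G · densityDeriv₀`
    have heq : (fun y => G y * densityDeriv p s b z 0 y) = fun y => G y *
        fderiv ℝ (fun q => p s q y)
          (z + (0 : ℝ) • (((0 : Fin N → ℝ), Pi.single b 1) : PhaseSpace N))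
          (((0 : Fin N → ℝ), Pi.single b 1) : PhaseSpace N) := by
      funext y
      rw [zero_smul, add_zero]
      change G y * partialP b (fun x => p s x y) z = _
      rw [partialP_eq_fderiv ((hp.contDiff_left hs0 y).differentiable one_ne_zero) b]
    rw [heq]
    exact hmain.2
  · exact Eventually.of_forall fun c =>
      (hGc'.mul (hp.contDiff_right hs0 _).continuous).aestronglyMeasurable
  · exact (hGc'.mul (hp.contDiff_right hs0 _).continuous).integrable_of_hasCompactSupport
      hGc.mul_right
  · exact (hGc'.mul (hDc.comp (continuous_id.prodMk continuous_const))).aestronglyMeasurable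
  · refine ae_of_all _ fun y c hc => ?_
    by_cases hy : y ∈ tsupport G
    · rw [Set.indicator_of_mem hy]
      exact hC₁ (y, _) ⟨hy, hseg c hc⟩
    · rw [Set.indicator_of_notMem hy, image_eq_zero_of_notMem_tsupport hy, zero_mul, norm_zero]
  · rw [integrable_indicator_iff hKm]
    exact integrableOn_const (hGc.isCompact.measure_lt_top).ne
  · refine ae_of_all _ fun y c _ => ?_
    have hpath : HasDerivAt (fun c : ℝ => z + c • (((0 : Fin N → ℝ), Pi.single b 1) : PhaseSpace N))
        (((0 : Fin N → ℝ), Pi.single b 1) : PhaseSpace N) c := by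
      simpa using ((hasDerivAt_id c).smul_const
        (((0 : Fin N → ℝ), Pi.single b 1) : PhaseSpace N)).const_add z
    have hd := (((hp.contDiff_left hs0 y).differentiable one_ne_zero) _).hasFDerivAt.comp_hasDerivAt
      c hpath
    exact hd.const_mul (G y)

end Density

end Summit.AtomisticToContinuum.FouriersLaw.Theorems.ExtensiveSnapshotIrreversibility.EnergyWindow

end
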